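import Literature.AnabelianGeometry.AbsoluteAnabelian.AbsTopIProp410TemperedModelResidues
import Literature.AnabelianGeometry.SemiGraphs.TemperedFreeTwoSlim
import Literature.AnabelianGeometry.SemiGraphs.TemperedProfiniteProducts
import Literature.AnabelianGeometry.SemiGraphs.OncePuncturedTemperedGroupPadicWitness
import HarnessLib

/-!
# [AbsTopI] Prop 4.10 (i), last clause, AT THE CONSTRUCTION is INHABITED at a NON-COMPACT tempered
# group: `Γ₂ × G_{ℚ_p}`, `Γ₂ = F̂₂ ×_Ẑ ℤ` (non-vacuity, proof-only)

S. Mochizuki, *Topics in Absolute Anabelian Geometry I: Generalities* [AbsTopI] (2012), §0 p. 8 (the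
`(Q, Δ)`-co-free completion), Prop 4.10 (i) p. 60 ("`π₁^tp(X)` [...] is naturally isomorphic to its
`π₁(X)`-co-free completion"); manuscript pagination, lit key `paper:url-11ac98ba15fc`, read on the page.
[SemiAnbd] Ex 3.10 pp. 43–45 / [EtTh] §1 p. 12: abc-iut-w5-d218's fibre product `Γ₂ = F̂₂ ×_Ẑ ℤ`
(tempered, slim, non-compact, `pr₁ : Γ₂ → F̂₂` the profinite completion).

Context: row iii.L02 of `HOME/plan/L4/SUBDAG-AbsTopI-Prop410.md` — `SelfCompletionAt Y`, Prop 4.10 (i)'s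
last clause at the §0 construction (`CoFreeCompletion` v2).  History: at the v1 topology the row was
FALSE at every non-compact datum (finding E-L4-7, abc-iut-L6-t21, kernel-witnessed); after REPAIR R1
(quotient topologies) abc-iut-L4-t13 gen 6 proved `SelfCompletionAt Y ⟺ (CF_Δ)` under `dY` + `hmin`
(`selfCompletionAt_iff_cofreeCore_cofinal_delta`).  THIS FILE gives the first kernel INHABITANT of the
row at a NON-COMPACT tempered group: `Y` with `Π^tp_Y := Γ₂ × G_{ℚ_p}` (`K = ℚ_p`, no points), where
(CF_Δ) and `hmin` are THEOREMS (`TemperedFibreProduct.cofreeCore_cofinal_index`,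
`exists_isMinimalCofreeIn_index`: the compact slice `Γ₀ × 1` meets every index in its minimal co-free
subgroup — "one-loop dual graph") and `dY` is built from the tree's slimness of `Γ₂`
(`TemperedFibreProduct.isSlimGroup`) and of `G_{ℚ_p}` ([pGC] Lem 15.8), `IsTempered.prod_of_profinite`
and Galois-countability.  Main statement: `SelfCompletionAt.exists_temperedModel` —
**`∃ Y, SelfCompletionAt Y ∧ ¬ CompactSpace Y.PiTemp ∧ Nonempty Y.GroupLevelData`**: the natural map
`Π^tp_Y → (Π^tp_Y)^{Π̂_Y/co-fr}` IS an isomorphism of topological groups at a datum whose tempered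
topology is genuinely finer than the profinite one.

HONEST LABEL: direct-product model (trivial Galois action), imitating a once-punctured Tate curve; not
the tempered fundamental group of a curve; consistency evidence for the repaired construction, not an
endorsement.  Proof-only (no `def`/instance/named fact; FACT-LIST untouched).  No side taken on
[IUTchIII] Cor 3.12; typed ≠ proved.
-/

noncomputable section

namespace Literature.AnabelianGeometry.AbsoluteAnabelian.AbsTopI.Prop410

open _root_.Topology _root_.Filter _root_.Set _root_.Function
open Literature.AnabelianGeometry.SemiGraphs
open Literature.AnabelianGeometry.AbsoluteAnabelian.AbsTopI
open Literature.IUT.HodgeTheaters (profiniteCompletion toCompletion toCompletion_int_injective)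
open Literature.AlgebraicGeometry.Frobenioids (IsSlimGroup)
open TemperedFibreProduct

/-- **[AbsTopI] Prop 4.10 (i), last clause, at the construction holds at the non-compact tempered group
`Γ₂ × G_{ℚ_p}`** (`Γ₂ = F̂₂ ×_Ẑ ℤ`): `SelfCompletionAt Y`, with `Π^tp_Y` not compact and the parameter
bundle `dY` inhabited. [cite: MochizukiAbsTopI2012, Prop 4.10 (i) p.60] -/
theorem SelfCompletionAt.exists_temperedModel (p : ℕ) [Fact p.Prime] :
    ∃ Y : TemperedCurve p, SelfCompletionAt Y ∧ ¬ CompactSpace Y.PiTemp ∧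
      Nonempty Y.GroupLevelData ∧ Y.K = ⊥ := by
  classical
  haveI : IsGalois ℚ_[p] (AlgebraicClosure ℚ_[p]) := {}
  haveI : T2Space (GQp p) := krullTopology_t2
  let P2 : ProfiniteGrp.{0} := profiniteCompletion (FreeGroup (Fin 2))
  let Zh : ProfiniteGrp.{0} := profiniteCompletion (Multiplicative ℤ)
  let η₂ : FreeGroup (Fin 2) →* P2 := toCompletion _
  let ι : Multiplicative ℤ →* Zh := toCompletion (Multiplicative ℤ)
  let τ : Fin 2 → FreeGroup (Fin 2) →* Multiplicative ℤ := fun i =>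
    FreeGroup.lift fun j => if j = i then Multiplicative.ofAdd (1 : ℤ) else 1
  let τx := τ 0; let τy := τ 1
  have hτxx : τx (FreeGroup.of 0) = Multiplicative.ofAdd 1 := by simp [τx, τ]
  have hτxy : τx (FreeGroup.of 1) = 1 := by simp [τx, τ]
  have hτyx : τy (FreeGroup.of 0) = 1 := by simp [τy, τ]
  have hτyy : τy (FreeGroup.of 1) = Multiplicative.ofAdd 1 := by simp [τy, τ]
  let e₂ : P2 →ₜ* Zh := (ProfiniteGrp.ProfiniteCompletion.lift (GrpCat.ofHom (ι.comp τx))).hom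
  let êy : P2 →ₜ* Zh := (ProfiniteGrp.ProfiniteCompletion.lift (GrpCat.ofHom (ι.comp τy))).hom
  let îx : Zh →ₜ* P2 :=
    (ProfiniteGrp.ProfiniteCompletion.lift (GrpCat.ofHom (η₂.comp (zpowersHom _ (FreeGroup.of 0))))).hom
  let îy : Zh →ₜ* P2 :=
    (ProfiniteGrp.ProfiniteCompletion.lift (GrpCat.ofHom (η₂.comp (zpowersHom _ (FreeGroup.of 1))))).hom
  have he₂ : ∀ w, e₂ (η₂ w) = ι (τx w) := fun w => lift_hom_toCompletion Zh (ι.comp τx) w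
  have hêy : ∀ w, êy (η₂ w) = ι (τy w) := fun w => lift_hom_toCompletion Zh (ι.comp τy) w
  have hîx : ∀ k : ℤ, îx (ι (Multiplicative.ofAdd k)) = η₂ (FreeGroup.of 0 ^ k) := fun k => by
    rw [lift_hom_toCompletion P2 (η₂.comp (zpowersHom _ (FreeGroup.of 0)))]; simp [zpowersHom_apply]
  have hîy : ∀ k : ℤ, îy (ι (Multiplicative.ofAdd k)) = η₂ (FreeGroup.of 1 ^ k) := fun k => by
    rw [lift_hom_toCompletion P2 (η₂.comp (zpowersHom _ (FreeGroup.of 1)))]; simp [zpowersHom_apply]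
  have hιinj : Injective ι := toCompletion_int_injective
  have hd2 : DenseRange η₂ := ProfiniteGrp.ProfiniteCompletion.denseRange (GrpCat.of (FreeGroup (Fin 2)))
  have hZ : ∀ A : Subgroup (Multiplicative ℤ), A.FiniteIndex →
      ∀ k : Multiplicative ℤ, ι k ∈ closure (ι '' (A : Set (Multiplicative ℤ))) → k ∈ A :=
    fun A hA k hk => by haveI := hA; exact mem_of_toCompletion_mem_closure A k hk
  haveI : SecondCountableTopology P2 := secondCountableTopology_profiniteCompletion_freeGroup (Fin 2)
  haveI := Literature.NumberTheory.LocalFields.secondCountableTopology_galQp p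
  have hslimG : IsSlimGroup (GQp p) :=
    IsSubpadicFor.isSlimGroup_absoluteGaloisGroup (AbsTopIII.IsSubpadicFor.padic p)
  -- the fibre product `Γ₂ = F̂₂ ×_Ẑ ℤ` for `ê_x`
  let Γ₂ : Subgroup (P2 × Multiplicative ℤ) :=
    (e₂.toMonoidHom.comp (MonoidHom.fst P2 (Multiplicative ℤ))).eqLocus
      (ι.comp (MonoidHom.snd P2 (Multiplicative ℤ)))
  have hΓ₂ : ∀ q : P2 × Multiplicative ℤ, q ∈ Γ₂ ↔ e₂ q.1 = ι q.2 := fun q => Iff.rfl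
  have hηN₂ : ∀ N : Subgroup (FreeGroup (Fin 2)), N.Normal → N.FiniteIndex →
      ∃ V : OpenNormalSubgroup P2, ∀ g, η₂ g ∈ V ↔ g ∈ N := fun N _ _ => exists_openNormal_eta_mem_iff N
  have hs₂ : Surjective τx := fun n => ⟨FreeGroup.of 0 ^ n.toAdd, by
    rw [map_zpow, hτxx, ← ofAdd_zsmul, smul_eq_mul, mul_one]; rfl⟩
  haveI : SecondCountableTopology Γ₂ := TemperedFibreProduct.secondCountableTopology Γ₂
  have hTΓ₂ : IsTempered Γ₂ := isTempered e₂ ι Γ₂ hΓ₂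
  have hSlimΓ₂ : IsSlimGroup Γ₂ :=
    TemperedFibreProduct.isSlimGroup e₂ êy îx îy τx τy hτxx hτxy hτyx hτyy he₂ hêy hîx hîy hιinj Γ₂ hΓ₂
  let toHatΓ₂ : Γ₂ →ₜ* P2 :=
    ⟨(MonoidHom.fst P2 (Multiplicative ℤ)).comp Γ₂.subtype, continuous_fst.comp continuous_subtype_val⟩
  have hPC₂ : IsProfiniteCompletion toHatΓ₂ :=
    isProfiniteCompletion_fst e₂ ι Γ₂ hΓ₂ η₂ hd2 hηN₂ τx hs₂ he₂ hZ toHatΓ₂ fun _ => rfl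
  have hinjΓ₂ : Injective toHatΓ₂ := fst_injective e₂ ι Γ₂ hΓ₂ hιinj
  have hsndΓ₂ : Surjective ((MonoidHom.snd P2 (Multiplicative ℤ)).comp Γ₂.subtype) :=
    snd_surjective_of e₂ ι Γ₂ hΓ₂ (exists_apply_eq_iota e₂ ι η₂ τx hs₂ he₂)
  have hgrmem₂ : ∀ g : FreeGroup (Fin 2), (η₂.prod τx) g ∈ Γ₂ := fun g => (hΓ₂ _).mpr (he₂ g)
  have htfgΓ₂ : IsTopologicallyFinitelyGenerated Γ₂ := by
    refine ⟨⟨_, topologicalClosure_closure_graph_eq_top e₂ ι Γ₂ hΓ₂ η₂ hd2 τx hs₂ he₂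
      hZ ((η₂.prod τx).codRestrict Γ₂ hgrmem₂) (fun _ => rfl)
      (Finset.univ.image (FreeGroup.of : Fin 2 → FreeGroup (Fin 2))) ?_⟩⟩
    rw [Finset.coe_image, Finset.coe_univ, Set.image_univ]; exact FreeGroup.closure_range_of _
  -- the tempered curve datum `Y`
  let sndG₂ : Γ₂ × GQp p →ₜ* GQp p := ContinuousMonoidHom.snd _ _
  let Y : TemperedCurve p :=
    { K := ⊥, finiteDimensional_K := inferInstance, PiTemp := Γ₂ × GQp p, aug := sndG₂
      range_aug := by
        rw [IntermediateField.fixingSubgroup_bot]; exact MonoidHom.range_eq_top.mpr Prod.snd_surjective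
      PiHat := P2 × GQp p
      toHat := toHatΓ₂.prodMap (ContinuousMonoidHom.id (GQp p))
      isProfiniteCompletion_toHat := hPC₂.prodMap_id
      toHat_injective := fun x y h => by
        have h1 := congrArg Prod.fst h; have h2 := congrArg Prod.snd h
        exact Prod.ext (hinjΓ₂ h1) h2
      augHat := ContinuousMonoidHom.snd _ _, augHat_comp := fun _ => rfl
      Pt := PEmpty, IsCusp := fun x => x.elim, decomp := fun x => x.elim
      isClosed_decomp := fun x => x.elim, isOpen_aug_decomp := fun x => x.elim
      inertia_eq_bot := fun x => x.elim, inertia_equiv_zHat := fun x => x.elim }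
  have hΔY : ∀ y : Γ₂ × GQp p, y ∈ Y.DeltaTemp ↔ y.2 = 1 := fun y => MonoidHom.mem_ker
  have hΔYeq : Y.DeltaTemp = (⊤ : Subgroup Γ₂).prod (⊥ : Subgroup (GQp p)) := by
    ext y; rw [hΔY, Subgroup.mem_prod, Subgroup.mem_bot]; simp
  let eY : Γ₂ ≃ₜ* Y.DeltaTemp :=
    { toFun := fun z => ⟨(z, 1), (hΔY _).2 rfl⟩
      invFun := fun y => y.1.1
      left_inv := fun z => rfl
      right_inv := fun y => Subtype.ext (Prod.ext rfl ((hΔY _).1 y.2).symm)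
      map_mul' := fun z w => Subtype.ext (Prod.ext rfl (mul_one (1 : GQp p)).symm)
      continuous_toFun := (continuous_id.prodMk continuous_const).subtype_mk _
      continuous_invFun := continuous_fst.comp continuous_subtype_val }
  -- the parameter bundle
  have hTY : IsTempered (Γ₂ × GQp p) := hTΓ₂.prod_of_profinite
  have hkerY : (Y.augK Y.galoisIdentification).toMonoidHom.ker = Y.DeltaTemp :=
    Y.ker_augK Y.galoisIdentification
  have dY : Y.GroupLevelData :=
    { galEquiv := Y.galoisIdentification, isTempered := hTY
      isTempered_ker := by rw [hkerY]; exact hTY.subgroup_of_isClosed _ Y.isClosed_deltaTemp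
      isSlimGroup := isSlimGroup_prod hSlimΓ₂ hslimG
      isSlimGroup_ker := by rw [hkerY]; exact isSlimGroup_of_continuousMulEquiv eY hSlimΓ₂
      secondCountableTopology := inferInstanceAs (SecondCountableTopology (Γ₂ × GQp p)) }
  -- the residues (CF_Δ) and `hmin`, and Prop 4.10 (i)
  have htfgY : IsTopologicallyFinitelyGenerated Y.DeltaTemp := htfgΓ₂.of_denseRange
    ({ toMonoidHom := eY.toMulEquiv.toMonoidHom, continuous_toFun := eY.continuous }) eY.surjective.denseRange
  have hCF := cofreeCore_cofinal_index e₂ ι Γ₂ hΓ₂ (G := GQp p) hΔYeq htfgY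
  have hmin := exists_isMinimalCofreeIn_index e₂ ι Γ₂ hΓ₂ (G := GQp p) hΔYeq
  have hself : SelfCompletionAt Y := (selfCompletionAt_iff_cofreeCore_cofinal_delta dY hmin).mpr hCF
  have hnc : ¬ CompactSpace Y.PiTemp :=
    not_compactSpace_of_continuous_surjective_int
      (((MonoidHom.snd P2 (Multiplicative ℤ)).comp Γ₂.subtype).comp (MonoidHom.fst Γ₂ (GQp p)))
      ((continuous_snd.comp continuous_subtype_val).comp continuous_fst)
      fun n => by obtain ⟨γ, hγ⟩ := hsndΓ₂ n; exact ⟨(γ, 1), hγ⟩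
  exact ⟨Y, hself, hnc, ⟨dY⟩, rfl⟩

end Literature.AnabelianGeometry.AbsoluteAnabelian.AbsTopI.Prop410

end
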